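import Literature.Computability.Complexity.MildHardLanguage
import HarnessLib

/-!
# Worst-case to mild average-case hardness at the level of one Boolean function
# (BFNW 1993 / Arora–Barak Thm. 19.21, the function form for the polynomial regime)

Literature / circuit complexity — derandomization. The first step of the pseudorandom generator from a
worst-case-hard TRUTH TABLE (IKW 2002, Thm. 11 = [BFNW93, KM99]; `HardnessVsRandomness.lean`,
`IKWGeneratorsProofs.lean`): from `f₀ : {0,1}^m → {0,1}` of large circuit complexity to an explicit
function `mildFn f₀ η` — the bits of the low-degree extension over `GF(2^{M+1})` of (the zero-padding of)
`f₀`, the `SelfCorrect.hardFn` of `WorstCaseToMild.lean` — such that every small circuit errs on a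
`1/len⁶` fraction of its inputs. This is the function-level form of `MildHard.mild_of_worst`
(`MildHardLanguage.lean`, which does it for LANGUAGES with `2^{εn}` hardness almost everywhere, the
first link of `impagliazzo_wigderson`); here the hardness threshold is arbitrary and the parameters are
those of `MildHardLanguage.lean` at a scale `η` with `m ≤ nOf η = η 2^η`:

* `MildHardFn.padFn f₀ η hm` (zero-padding to `nOf η` variables), `MildHardFn.srcFn` (as a function on the
  cube `(Fin k → Fin η → Bool)`, `srcFn_rows`), **`MildHardFn.mildFn f₀ η hm`** (`hardFn ∘ idx`, on
  `lenOf η` bits);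
* `MildHardFn.circuitSizeOver_le_of_cktSize_padFn` — a circuit for the padding gives one for `f₀`
  (hard-wire the padding zeros: `+ 2` gates);
* **`MildHardFn.mild_of_worst`** — for `η ≥ 2` and a `B₂`-circuit `C'` on `lenOf η` inputs with
  `432 · A⁶ (|C'| + 11) + 2 < circuitSizeOver B2 f₀` (`A = AOf η = 4^{η+1}`), the circuit errs on at least
  `2^{lenOf η} / (lenOf η)⁶` inputs of `mildFn f₀ η hm` (the mildness condition `cond_wrong`, the reduction
  `cktSize_of_mildCircuit` and the size bound `redSize_le` of the tree);
* the scale: `MildHardFn.exists_eta` (`η ≥ 2` with `m ≤ nOf η` and `2^η ≤ 2m + 4`), for the polynomial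
  bookkeeping downstream.

Everything is proved. Mathlib has none of this; nothing duplicates the tree (searched `mildFn`, `padFn`,
`mild_of_worst`: only the language version).

## References

* S. Arora, B. Barak, *Computational Complexity: A Modern Approach*, CUP 2009, Thm. 19.21 and its proof
  [AroraBarakCC2009].
* L. Babai, L. Fortnow, N. Nisan, A. Wigderson, *BPP has subexponential time simulations unless EXPTIME
  has publishable proofs*, Comput. Complexity 3 (1993) 307–318, §4.
* R. Impagliazzo, V. Kabanets, A. Wigderson, *In search of an easy witness*, JCSS 65 (2002), Thm. 11
  [ImpagliazzoKabanetsWigderson2002].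
-/

noncomputable section

namespace Literature.Computability.Complexity

open Finset MetaComplexity SelfCorrect MildHard

namespace MildHardFn

variable {m : ℕ} (f₀ : (Fin m → Bool) → Bool) (η : ℕ) (hm : m ≤ nOf η)

/-! ### The padded function and the mildly hard function -/

/-- **Zero-padding** `f₀` to `nOf η = η 2^η` variables: read the first `m`. [cite: AroraBarakCC2009, Thm. 19.21 (proof, footnote: padding)] -/
def padFn (u : Fin (nOf η) → Bool) : Bool := f₀ fun i => u (Fin.castLE hm i)

/-- The padded function on the cube `(Fin k → Fin η → Bool)`, `k = 2^η` (row-major). [folklore] -/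
def srcFn (a : Fin (kOf η) → Fin η → Bool) : Bool :=
  padFn f₀ η hm fun p => a (finProdFinEquiv.symm p).1 (finProdFinEquiv.symm p).2

/-- Rows and the source function: `srcFn (rows u) = padFn u`. [folklore] -/
theorem srcFn_rows (u : Fin (nOf η) → Bool) : srcFn f₀ η hm (rows (kOf η) η u) = padFn f₀ η hm u := by
  unfold srcFn rows
  congr 1
  funext p
  have : finProdFinEquiv (p.divNat, p.modNat) = p := finProdFinEquiv.apply_symm_apply p
  simp [this]

/-- **The mildly hard function** of `f₀` at scale `η`: the hard function `g` of the padded `f₀`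
(coordinates of its low-degree extension), read off `lenOf η` bits. [cite: AroraBarakCC2009, Thm. 19.21] -/
def mildFn (w' : Fin (lenOf η) → Bool) : Bool := hardFn (srcFn f₀ η hm) fun q => w' (idx η q)

/-! ### From a circuit for the padding to a circuit for `f₀` -/

/-- Extending `m` bits by zeros to `nOf η` bits. [folklore] -/
def extend (u : Fin m → Bool) (j : Fin (nOf η)) : Bool := if h : (j : ℕ) < m then u ⟨j, h⟩ else false

/-- The padded function on an extended input is `f₀`. [folklore] -/
theorem padFn_extend (u : Fin m → Bool) : padFn f₀ η hm (extend η u) = f₀ u := by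
  unfold padFn extend
  congr 1
  funext i
  simp [i.isLt]

/-- **A circuit for the padding gives a circuit for `f₀`** (hard-wire the zeros: two constant gates).
[cite: AroraBarakCC2009, Thm. 19.21 (proof)] -/
theorem circuitSizeOver_le_of_cktSize_padFn {s : ℕ}
    (h : CktSize B2 (fun (u : Fin (nOf η) → Bool) (_ : Unit) => padFn f₀ η hm u) s) :
    circuitSizeOver B2 f₀ ≤ s + 2 := by
  classical
  have hN : m + (nOf η - m) = nOf η := Nat.add_sub_cancel' hm
  -- split the variables into the first `m` and the rest
  let sp : Fin (nOf η) → Fin m ⊕ Fin (nOf η - m) := fun j => finSumFinEquiv.symm (Fin.cast hN.symm j)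
  have h1 := h.rewire (ι' := Fin m ⊕ Fin (nOf η - m)) sp
  have h2 := h1.hardwire fun _ => false
  have h3 : CktSize B2 (fun (u : Fin m → Bool) (_ : Unit) => f₀ u) (s + 2) := by
    refine h2.congr fun u _ => ?_
    rw [← padFn_extend f₀ η hm u]
    unfold padFn
    congr 1
    funext i
    simp only [extend]
    have hi : ((Fin.castLE hm i : Fin (nOf η)) : ℕ) < m := by simp [i.isLt]
    rw [dif_pos hi]
    have hsp : sp (Fin.castLE hm i) = Sum.inl i := by
      simp only [sp]
      rw [Equiv.symm_apply_eq]
      apply Fin.ext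
      simp
    rw [hsp, Sum.elim_inl]
    congr 1
  obtain ⟨K, hKB, hKs, hKe⟩ := h3.toCircuit
  exact (circuitSizeOver_le_of_computes K hKB hKe).trans hKs

/-! ### The mild hardness -/

/-- **Worst-case hardness of `f₀` gives mild hardness of `mildFn f₀ η`** (Arora–Barak Thm. 19.21 at the
level of one function): for `η ≥ 2` and a `B₂`-circuit `C'` on `lenOf η` inputs with
`432 · A⁶ (|C'| + 11) + 2 < circuitSizeOver B2 f₀`, `A = 4^{η+1}`, the circuit errs on at least
`2^{lenOf η} / (lenOf η)⁶` inputs: otherwise the self-corrector of `WorstCaseToMild.lean`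
(`cktSize_of_mildCircuit`, mildness condition `cond_wrong`, size `redSize_le`) computes the padded `f₀`,
hence `f₀`, by a circuit of size `≤ 432 A⁶ (|C'| + 11) + 2`. [cite: AroraBarakCC2009, Thm. 19.21] -/
theorem mild_of_worst (hη : 2 ≤ η) (C' : Circuit (Fin (lenOf η))) (hB' : C'.IsOver B2)
    (hsize : 432 * AOf η ^ 6 * (C'.size + 11) + 2 < circuitSizeOver B2 f₀) :
    (2 : ℝ) ^ lenOf η ≤ (lenOf η : ℝ) ^ 6 * #{w' : Fin (lenOf η) → Bool | C'.eval w' ≠ mildFn f₀ η hm w'} := by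
  classical
  by_contra hcon
  push Not at hcon
  set f := srcFn f₀ η hm with hf
  -- re-index to the hard function's input format
  obtain ⟨C₂, hB₂, hs₂, he₂⟩ := ((C'.cktSize_eval hB').rewire (ι' := ZIdx (kOf η) (MOf η) ⊕ Fin (MOf η + 1))
    (idx η).symm).toCircuit
  have hwrong₂ : #(wrong C₂ f) = #{w' : Fin (lenOf η) → Bool | C'.eval w' ≠ mildFn f₀ η hm w'} := by
    refine card_equiv (Equiv.arrowCongr (idx η) (Equiv.refl Bool)) fun wq => ?_
    simp only [wrong, mem_filter, mem_univ, true_and, he₂, mildFn, hf, Equiv.arrowCongr_apply, Equiv.coe_refl,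
      Function.comp_apply, Equiv.symm_apply_apply]
    exact Iff.rfl
  -- the mildness condition
  have hcond := cond_wrong (by omega : 1 ≤ η) (le_refl (lenOf η))
  have hw2 : 3 * ((DOf η + 1) * ((MOf η + 1) * #(wrong C₂ f))) ≤ 2 ^ (kOf η * (MOf η + 1)) := by
    have h1 : ((lenOf η : ℕ) : ℝ) ^ 6 * (#(wrong C₂ f) : ℕ) < (2 : ℝ) ^ lenOf η := by
      rw [hwrong₂]; exact hcon
    have h2 : lenOf η ^ 6 * #(wrong C₂ f) < 2 ^ lenOf η := by exact_mod_cast h1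
    have h5 : 2 ^ lenOf η = 2 ^ (kOf η * (MOf η + 1)) * 2 ^ (MOf η + 1) := by unfold lenOf; rw [← pow_add]
    rw [h5] at h2
    have h6 : 3 * ((DOf η + 1) * ((MOf η + 1) * #(wrong C₂ f))) * 2 ^ (MOf η + 1) ≤ lenOf η ^ 6 * #(wrong C₂ f) := by
      have := Nat.mul_le_mul_right #(wrong C₂ f) hcond
      calc _ = 3 * ((DOf η + 1) * ((MOf η + 1) * 2 ^ (MOf η + 1))) * #(wrong C₂ f) := by ring
        _ ≤ lenOf η ^ 6 * #(wrong C₂ f) := this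
    exact Nat.le_of_lt_succ (Nat.lt_succ_of_lt (Nat.lt_of_mul_lt_mul_right (lt_of_le_of_lt h6 h2)))
  -- the reduction: a circuit for the padded `f₀`
  obtain ⟨τ, hτ, hτ0⟩ := exists_nodes (params_fit η).2
  have hred := cktSize_of_mildCircuit C₂ f τ (params_fit η).1 (le_refl _) hτ hτ0 hB₂ hw2
  have hred' : CktSize B2 (fun (u : Fin (nOf η) → Bool) (_ : Unit) => padFn f₀ η hm u)
      (27 * (2 * (kOf η * η) + 2) ^ 2 * (trialSize (kOf η) (MOf η) (DOf η) C₂.size + 3)) :=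
    hred.congr fun u _ => srcFn_rows f₀ η hm u
  have hcso := circuitSizeOver_le_of_cktSize_padFn f₀ η hm hred'
  -- sizes
  have hC₂ : C₂.size + 11 ≤ C'.size + 11 := by omega
  have hchain : 27 * (2 * (kOf η * η) + 2) ^ 2 * (trialSize (kOf η) (MOf η) (DOf η) C₂.size + 3) ≤
      432 * AOf η ^ 6 * (C'.size + 11) :=
    (redSize_le hη C₂.size).trans (Nat.mul_le_mul_left _ hC₂)
  omega

/-! ### The scale -/

/-- **A scale for `m` variables**: some `η ≥ 2` has `m ≤ nOf η` and `2^η ≤ 2m + 4` (so that all parameters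
at this scale are polynomial in `m`). [folklore] -/
theorem exists_eta (m : ℕ) : ∃ η : ℕ, 2 ≤ η ∧ m ≤ nOf η ∧ 2 ^ η ≤ 2 * m + 4 := by
  classical
  have hex : ∃ η : ℕ, 2 ≤ η ∧ m ≤ nOf η := by
    refine ⟨m + 2, by omega, ?_⟩
    unfold nOf kOf
    calc m ≤ m + 2 := by omega
      _ ≤ 2 ^ (m + 2) * (m + 2) := Nat.le_mul_of_pos_left _ Nat.one_le_two_pow
  refine ⟨Nat.find hex, (Nat.find_spec hex).1, (Nat.find_spec hex).2, ?_⟩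
  set η := Nat.find hex with hη
  rcases (Nat.find_spec hex).1.eq_or_lt with h2 | hgt
  · rw [hη, ← h2]; omega
  · -- minimality: `η - 1 ≥ 2` fails, so `nOf (η - 1) < m`
    have hmin := Nat.find_min hex (show η - 1 < Nat.find hex by omega)
    have hlt : nOf (η - 1) < m := by
      by_contra hle
      exact hmin ⟨by omega, not_lt.1 hle⟩
    unfold nOf kOf at hlt
    have h1 : 2 ^ (η - 1) ≤ 2 ^ (η - 1) * (η - 1) := Nat.le_mul_of_pos_right _ (by omega)
    have h2 : 2 ^ η = 2 * 2 ^ (η - 1) := by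
      rw [← pow_succ']; congr 1; omega
    omega

/-- At such a scale `AOf η = 4^{η+1} ≤ 4 (2m + 4)²`. [folklore] -/
theorem AOf_le_of_two_pow_le {η m : ℕ} (h : 2 ^ η ≤ 2 * m + 4) : AOf η ≤ 4 * (2 * m + 4) ^ 2 := by
  unfold AOf
  have : (4 : ℕ) ^ η = (2 ^ η) ^ 2 := by rw [← pow_mul, mul_comm, pow_mul]; norm_num
  rw [pow_succ, this]
  nlinarith [Nat.pow_le_pow_left h 2]

/-- At such a scale `lenOf η ≤ (2m + 4)(4m + 10) + (4m + 10)`. [folklore] -/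
theorem lenOf_le_of_two_pow_le {η m : ℕ} (h : 2 ^ η ≤ 2 * m + 4) :
    lenOf η ≤ (2 * m + 4) * (4 * m + 10) + (4 * m + 10) := by
  unfold lenOf kOf
  rw [MOf_succ]
  have hη : η ≤ 2 ^ η := Nat.lt_two_pow_self.le
  have h1 : 2 * η + 2 ≤ 4 * m + 10 := by omega
  nlinarith

end MildHardFn

end Literature.Computability.Complexity

end
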